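import Literature.Topology.FourManifolds.SmaleDiffDisc
import Literature.Analysis.ODE.ParametricGlobalFlow
import HarnessLib

/-!
# Smale's straightening isotopy in smooth families

Topic `Literature/Topology/FourManifolds`. J. Cerf, *Sur les difféomorphismes de la sphère de
dimension trois (Γ₄ = 0)*, LNM 53 (1968), Appendice §5, **Théorème 4** ("le théorème de Smale"):
*le groupe `𝒦` des difféomorphismes de `D²` infiniment tangents à l'identité le long de `S¹` a tous
ses groupes d'homotopie nuls, `π_i(𝒦) = 0` pour tout `i`* — S. Smale, *Diffeomorphisms of the
2-sphere*, Proc. AMS 10 (1959), Thm. B: the space of diffeomorphisms of the square which are the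
identity near the boundary is contractible. `SmaleStraightening.lean` / `SmaleDiffDisc.lean` prove
the case `i = 0`; the higher `π_i` require Smale's construction to be run **in smooth families**:
for a family of compactly supported diffeomorphisms depending smoothly on a parameter `u` in a
finite-dimensional space `P`, every object of the construction depends smoothly on `u` as well.
This file does this for the re-integration step (the analytic core):

* `contDiff_inverse_family` — **smooth families of diffeomorphisms have smooth families of
  inverses**: if `(w, x) ↦ F w x` is smooth on `W × E` (Banach), every `F w` is a bijection with
  invertible derivative everywhere and `G w` is its inverse, then `(w, y) ↦ G w y` is smooth (the
  inverse function theorem for the "track" `(w, x) ↦ (w, F w x)`);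
* `exists_lipschitzOnWith_of_eq_const_off_disc` — a `C¹` map on `W × ℂ` which is constant off
  `W × (unit disc)` is Lipschitz on `B(w₀, 1) × ℂ` (bounded derivative on a convex set);
* `exists_ambientIsotopy_flowStraighten_family` — **the straightening isotopies of a smooth
  family of angle functions `Θ_u` form a smooth family**: the statement of
  `exists_ambientIsotopy_flowStraighten` for every `u`, the joint smoothness of
  `(u, τ, z) ↦ E^u_τ z` (smooth dependence of global flows on parameters,
  `Literature.Analysis.ODE.contDiff_parametric_globalFlow`, applied to the fields
  `exp (χ(τ) Θ_u)` parametrised by `(u, τ)`), and **naturality at trivial parameters**: where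
  `Θ_u = 0` every stage `E^u_τ` is the identity (the field is `1`, its flow is translation).

Everything here is proved; there are no definitions and no named facts.

## References

* J. Cerf, *Sur les difféomorphismes de la sphère de dimension trois (Γ₄ = 0)*, Lecture Notes in
  Mathematics 53, Springer (1968), Appendice §5, Théorème 4. [CerfDiffeoSphere1968]
* S. Smale, *Diffeomorphisms of the 2-sphere*, Proc. Amer. Math. Soc. 10 (1959) 621–626, Thm. B.
* S. Lang, *Differential and Riemannian Manifolds*, GTM 160 (1995), Ch. IV §1, Thm. 1.16 and
  Ch. I §5 (inverse mapping theorem). [Lang1995]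
-/

noncomputable section

open Complex Set Filter Function Metric Topology
open scoped Real NNReal Manifold ContDiff
open Literature.Analysis.ODE Literature.Topology.PlaneTopology

namespace Literature.Topology.FourManifolds

/-! ### Smooth families of diffeomorphisms have smooth families of inverses -/

section InverseFamily

variable {W : Type*} [NormedAddCommGroup W] [NormedSpace ℝ W] [CompleteSpace W]
  {E : Type*} [NormedAddCommGroup E] [NormedSpace ℝ E] [CompleteSpace E]

/-- **Smooth families of diffeomorphisms have smooth families of inverses** (inverse function
theorem applied to the track `(w, x) ↦ (w, F w x)`, a bijection of `W × E` whose derivative is the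
invertible shear `(s, v) ↦ (s, D (s, v))`). Lang (1995), Ch. I §5. [cite: Lang1995, Ch. I §5, Thm. 5.2] -/
theorem contDiff_inverse_family {F G : W → E → E} (hF : ContDiff ℝ ∞ fun p : W × E => F p.1 p.2)
    (hGF : ∀ w x, G w (F w x) = x) (hFG : ∀ w y, F w (G w y) = y)
    (hD : ∀ w x, ∃ M : E ≃L[ℝ] E, HasFDerivAt (F w) (M : E →L[ℝ] E) x) :
    ContDiff ℝ ∞ fun p : W × E => G p.1 p.2 := by
  -- the track and its inverse
  set T : W × E → W × E := fun p => (p.1, F p.1 p.2) with hT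
  have hTs : ContDiff ℝ ∞ T := contDiff_fst.prodMk hF
  have hTbij : Bijective T := by
    refine ⟨fun p q h => ?_, fun q => ⟨(q.1, G q.1 q.2), ?_⟩⟩
    · obtain ⟨w, x⟩ := p
      obtain ⟨w', x'⟩ := q
      simp only [hT, Prod.mk.injEq] at h
      obtain ⟨rfl, h2⟩ := h
      have := congrArg (G w) h2
      rw [hGF, hGF] at this
      rw [this]
    · simp only [hT, hFG]
  -- the track is a local diffeomorphism everywhere
  have hTloc : IsLocalDiffeomorph 𝓘(ℝ, W × E) 𝓘(ℝ, W × E) ∞ T := by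
    intro p
    obtain ⟨M, hM⟩ := hD p.1 p.2
    set D : W × E →L[ℝ] E := fderiv ℝ (fun p : W × E => F p.1 p.2) p with hDdef
    have hFd : HasFDerivAt (fun p : W × E => F p.1 p.2) D p := (hF.differentiable (by simp) p).hasFDerivAt
    -- `M = D ∘ inr`
    have hMD : (M : E →L[ℝ] E) = D.comp (ContinuousLinearMap.inr ℝ W E) := by
      have h1 : HasFDerivAt (F p.1) (D.comp (ContinuousLinearMap.inr ℝ W E)) p.2 := by
        have h2 : HasFDerivAt (fun x : E => ((p.1, x) : W × E)) (ContinuousLinearMap.inr ℝ W E) p.2 :=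
          hasFDerivAt_prodMk_right p.1 p.2
        have := hFd.comp p.2 h2
        exact this
      exact hM.unique h1
    set L : (W × E) ≃L[ℝ] (W × E) :=
      (ContinuousLinearEquiv.refl ℝ W).skewProd M (D.comp (ContinuousLinearMap.inl ℝ W E)) with hL
    have hLD : (L : W × E →L[ℝ] W × E) = (ContinuousLinearMap.fst ℝ W E).prod D := by
      refine ContinuousLinearMap.ext fun q => ?_
      obtain ⟨s, v⟩ := q
      have hMv : M v = D (0, v) := by
        have := congrArg (fun T : E →L[ℝ] E => T v) hMD
        simpa using this
      have h : D (0, v) + D (s, 0) = D (s, v) := by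
        rw [← map_add, Prod.mk_add_mk, zero_add, add_zero]
      rw [hL, ContinuousLinearEquiv.coe_coe, ContinuousLinearEquiv.skewProd_apply,
        ContinuousLinearMap.prod_apply]
      dsimp only
      rw [ContinuousLinearEquiv.refl_apply, ContinuousLinearMap.comp_apply,
        ContinuousLinearMap.inl_apply, hMv, h]
      rfl
    refine isLocalDiffeomorphAt_of_hasFDerivAt_writtenInExtChartAt (U := univ) isOpen_univ
      (mem_univ p) hTs.contMDiff.contMDiffOn (by exact_mod_cast le_top) L ?_
    rw [hLD]
    exact hasFDerivAt_fst.prodMk hFd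
  -- hence a diffeomorphism; its inverse is smooth and is `(w, y) ↦ (w, G w y)`
  set Tdiff := hTloc.diffeomorphOfBijective hTbij with hTdiff
  have hcoe : ⇑Tdiff = T := rfl
  have hsymm : ∀ q : W × E, Tdiff.symm q = (q.1, G q.1 q.2) := by
    intro q
    have h1 : Tdiff (q.1, G q.1 q.2) = q := by
      rw [hcoe]
      simp only [hT, hFG, Prod.mk.eta]
    calc Tdiff.symm q = Tdiff.symm (Tdiff (q.1, G q.1 q.2)) := by rw [h1]
      _ = (q.1, G q.1 q.2) := Tdiff.symm_apply_apply _
  have hsmooth : ContDiff ℝ ∞ fun q : W × E => (q.1, G q.1 q.2) := by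
    have heq : (fun q : W × E => (q.1, G q.1 q.2)) = ⇑Tdiff.symm := funext fun q => (hsymm q).symm
    rw [heq]
    exact contMDiff_iff_contDiff.mp Tdiff.symm.contMDiff
  exact contDiff_snd.comp hsmooth

end InverseFamily

/-! ### Lipschitz control of families constant off the disc -/

section Lipschitz

variable {W : Type*} [NormedAddCommGroup W] [NormedSpace ℝ W] [FiniteDimensional ℝ W]
  {V : Type*} [NormedAddCommGroup V] [NormedSpace ℝ V]

/-- A `C¹` map on `W × ℂ` (`W` finite-dimensional) which is constant off `W × (closed unit disc)`
is Lipschitz on `B(w₀, 1) × ℂ`: its derivative vanishes off the disc and is bounded on the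
compact `B̄(w₀, 1) × D̄`, and the set is convex. [folklore] -/
theorem exists_lipschitzOnWith_of_eq_const_off_disc {G : W × ℂ → V} (hG : ContDiff ℝ 1 G) {c : V}
    (hout : ∀ (w : W) (z : ℂ), 1 ≤ ‖z‖ → G (w, z) = c) (w₀ : W) :
    ∃ L : ℝ≥0, LipschitzOnWith L G (ball w₀ 1 ×ˢ univ) := by
  have hd : Differentiable ℝ G := hG.differentiable (by simp)
  have hc : Continuous (fderiv ℝ G) := hG.continuous_fderiv (by simp)
  -- bound on the compact part
  haveI : ProperSpace W := FiniteDimensional.proper ℝ W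
  obtain ⟨C, hC⟩ := ((isCompact_closedBall w₀ 1).prod (isCompact_closedBall (0 : ℂ) 1)).exists_bound_of_continuousOn
    hc.continuousOn
  have hC0 : 0 ≤ C := (norm_nonneg _).trans (hC (w₀, 0) ⟨mem_closedBall_self zero_le_one,
    mem_closedBall_self zero_le_one⟩)
  -- the derivative vanishes off the disc
  have hzero : ∀ (w : W) (z : ℂ), 1 < ‖z‖ → fderiv ℝ G (w, z) = 0 := by
    intro w z hz
    have hev : G =ᶠ[𝓝 (w, z)] fun _ => c := by
      have hopen : IsOpen {p : W × ℂ | 1 < ‖p.2‖} := isOpen_lt continuous_const (continuous_norm.comp continuous_snd)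
      filter_upwards [hopen.mem_nhds (show (w, z) ∈ {p : W × ℂ | 1 < ‖p.2‖} from hz)] with p hp
      exact hout p.1 p.2 hp.le
    rw [hev.fderiv_eq, fderiv_const_apply]
  refine ⟨⟨C, hC0⟩, (convex_ball w₀ 1).prod convex_univ |>.lipschitzOnWith_of_nnnorm_fderiv_le
    (fun p _ => hd p) fun p hp => ?_⟩
  rw [← NNReal.coe_le_coe, coe_nnnorm]
  change ‖fderiv ℝ G p‖ ≤ C
  by_cases hz : ‖p.2‖ ≤ 1
  · exact hC p ⟨ball_subset_closedBall hp.1, mem_closedBall_zero_iff.2 hz⟩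
  · have := hzero p.1 p.2 (not_le.1 hz)
    rw [show p = (p.1, p.2) from rfl, this, norm_zero]
    exact hC0

end Lipschitz

/-! ### The straightening isotopies of a smooth family of angle functions -/

section Family

variable {P : Type*} [NormedAddCommGroup P] [NormedSpace ℝ P] [FiniteDimensional ℝ P]
  {Θ : P → ℂ → ℂ}

/-- **Smale's straightening isotopy in smooth families** (Cerf 1968, Appendice §5, Théorème 4,
families form of the re-integration step of Smale 1959, Thm. B). Let `Θ : P → ℂ → ℂ` be jointly
smooth in `(u, z)` (`P` a finite-dimensional parameter space), each `Θ_u` purely imaginary and zero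
off the closed unit disc. Then the straightening isotopies `E^u` of the fields `exp (χ(τ) Θ_u)`
(`exists_ambientIsotopy_flowStraighten`, with all six of its properties for every `u`) can be chosen
**jointly smooth in `(u, τ, z)`**, and **equal to the identity at every parameter `u` where
`Θ_u = 0`**. [cite: CerfDiffeoSphere1968, Appendice §5, Théorème 4] -/
theorem exists_ambientIsotopy_flowStraighten_family (hΘ : ContDiff ℝ ∞ fun q : P × ℂ => Θ q.1 q.2)
    (hΘout : ∀ u z, 1 ≤ ‖z‖ → Θ u z = 0) (hΘre : ∀ u z, (Θ u z).re = 0) :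
    ∃ A : P → AmbientIsotopy 𝓘(ℝ, ℂ) ℂ,
      (ContDiff ℝ ∞ fun q : P × ℝ × ℂ => (A q.1).toFun q.2.1 q.2.2) ∧
      (∀ u, (∀ z, Θ u z = 0) → ∀ (τ : ℝ) (z : ℂ), (A u).toFun τ z = z) ∧
      ∀ u,
      (∀ (τ : ℝ) (z : ℂ), 1 ≤ |z.im| → (A u).toFun τ z = z) ∧
      (∀ (τ : ℝ) (z : ℂ), z.re ≤ -1 → (A u).toFun τ z = z) ∧
      (∀ (τ : ℝ) (z : ℂ) (d : ℝ), 0 ≤ d → 1 ≤ ((A u).toFun τ z).re → (A u).toFun τ (z + d) = (A u).toFun τ z + d) ∧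
      (∀ (τ : ℝ) (z : ℂ), ((A u).toFun τ z).re ≤ z.re) ∧
      (∀ (τ : ℝ) (z : ℂ), 1 ≤ ‖(A u).toFun τ z‖ → fderiv ℝ ((A u).toFun τ) z 1 = 1) ∧
      (∀ F : ℂ → ℝ, Differentiable ℝ F → (∀ z, fderiv ℝ F z (exp (Θ u z)) = 0) →
        (∀ z, 1 ≤ ‖z‖ → F z = z.im) → ∀ z, F ((A u).toFun 1 z) = z.im) := by
  have hΘu : ∀ u, ContDiff ℝ ∞ (Θ u) := fun u => hΘ.comp (contDiff_const.prodMk contDiff_id)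
  -- per-parameter data of the fields `X^u_τ = exp (χ τ Θ_u)`
  choose K hsmooth hnorm hout hK using fun u => field_family_props (hΘu u) (hΘout u) (hΘre u)
  have hB : ∀ (u : P) (τ : ℝ) (z : ℂ), ‖exp (((Real.smoothTransition τ : ℝ) : ℂ) * Θ u z)‖ ≤ 1 :=
    fun u τ z => (hnorm u τ z).le
  have hC1 : ∀ (u : P) (τ : ℝ), ContDiff ℝ 1 fun z : ℂ => exp (((Real.smoothTransition τ : ℝ) : ℂ) * Θ u z) :=
    fun u τ => (hsmooth u τ).of_le (by simp)
  have hne : ∀ (u : P) (τ : ℝ) (z : ℂ), exp (((Real.smoothTransition τ : ℝ) : ℂ) * Θ u z) ≠ 0 := fun u τ z => exp_ne_zero _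
  have hlog : ∀ (u : P) (τ : ℝ), HasLogOn (fun z : ℂ => exp (((Real.smoothTransition τ : ℝ) : ℂ) * Θ u z)) univ := fun u τ =>
    ⟨fun z => ((Real.smoothTransition τ : ℝ) : ℂ) * Θ u z, (continuous_const.mul (hΘu u).continuous).continuousOn,
      fun z _ => rfl⟩
  have hesc : ∀ (u : P) (τ : ℝ) (w : ℂ) (R : ℝ), ∃ t : ℝ, t ≤ 0 ∧ R < ‖globalFlow (hK u τ) (hB u τ) w t‖ := fun u τ =>
    exists_lt_norm_globalFlow_of_nonpos (hC1 u τ) (hK u τ) (hB u τ) (hne u τ) (hlog u τ)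
  /- joint smoothness of `(u, τ, z, t) ↦ Φ^{u,τ}_t z` in the parameter `w = (u, τ)` -/
  set Y : (P × ℝ) → ℂ → ℂ := fun w z => exp (((Real.smoothTransition w.2 : ℝ) : ℂ) * Θ w.1 z) with hY_def
  have hYs : ContDiff ℝ ∞ fun p : (P × ℝ) × ℂ => Y p.1 p.2 := by
    refine ((Complex.contDiff_exp (𝕜 := ℂ)).restrict_scalars ℝ).comp ?_
    exact (ofRealCLM.contDiff.comp (Real.smoothTransition.contDiff.comp (contDiff_snd.comp contDiff_fst))).mul
      (hΘ.comp ((contDiff_fst.comp contDiff_fst).prodMk contDiff_snd))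
  have hYK : ∀ w : P × ℝ, LipschitzWith (K w.1) (Y w) := fun w => hK w.1 w.2
  have hYB : ∀ (w : P × ℝ) (z : ℂ), ‖Y w z‖ ≤ (1 : ℝ) := fun w z => hB w.1 w.2 z
  have hYout : ∀ (w : P × ℝ) (z : ℂ), 1 ≤ ‖z‖ → (fun p : (P × ℝ) × ℂ => Y p.1 p.2) (w, z) = 1 :=
    fun w z hz => hout w.1 w.2 z hz
  have hYloc : ∀ w₀ : P × ℝ, ∃ ε : ℝ, 0 < ε ∧ (∃ L : ℝ≥0, LipschitzOnWith L (fun p : (P × ℝ) × ℂ => Y p.1 p.2)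
      (ball w₀ ε ×ˢ univ)) ∧ ∃ C : ℝ, ∀ w ∈ ball w₀ ε, ∀ z, ‖Y w z‖ ≤ C := by
    intro w₀
    obtain ⟨L, hL⟩ := exists_lipschitzOnWith_of_eq_const_off_disc (hYs.of_le (by simp)) hYout w₀
    exact ⟨1, one_pos, ⟨L, hL⟩, 1, fun w _ z => hYB w z⟩
  have hflow : ContDiff ℝ ∞ fun p : (P × ℝ) × ℂ × ℝ => globalFlow (hYK p.1) (hYB p.1) p.2.1 p.2.2 :=
    contDiff_parametric_globalFlow hYs (by simp) hYK hYB hYloc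
  -- joint smoothness of `(u, τ, z) ↦ E^u_τ z`
  have hjoint : ContDiff ℝ ∞ fun q : P × ℝ × ℂ =>
      globalFlow (hK q.1 q.2.1) (hB q.1 q.2.1) (-2 + (q.2.2.im : ℂ) * I) (q.2.2.re + 2) := by
    have hin : ContDiff ℝ ∞ fun q : P × ℝ × ℂ =>
        ((((q.1, q.2.1) : P × ℝ), ((-2 : ℂ) + (q.2.2.im : ℂ) * I, q.2.2.re + 2)) : (P × ℝ) × ℂ × ℝ) := by
      refine (contDiff_fst.prodMk (contDiff_fst.comp contDiff_snd)).prodMk (ContDiff.prodMk ?_ ?_)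
      · exact contDiff_const.add ((ofRealCLM.contDiff.comp (Complex.imCLM.contDiff.comp
          (contDiff_snd.comp contDiff_snd))).mul contDiff_const)
      · exact (Complex.reCLM.contDiff.comp (contDiff_snd.comp contDiff_snd)).add contDiff_const
    exact hflow.comp hin
  have hjoint_u : ∀ u : P, ContDiff ℝ ∞ fun q : ℝ × ℂ =>
      globalFlow (hK u q.1) (hB u q.1) (-2 + (q.2.im : ℂ) * I) (q.2.re + 2) := fun u =>
    hjoint.comp (contDiff_const.prodMk contDiff_id)
  have hstage : ∀ (u : P) (τ : ℝ), ContDiff ℝ ∞ fun z : ℂ =>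
      globalFlow (hK u τ) (hB u τ) (-2 + (z.im : ℂ) * I) (z.re + 2) := fun u τ =>
    (hjoint_u u).comp (contDiff_const.prodMk contDiff_id)
  -- the stage `0` is the identity
  have h0 : ∀ u : P, (fun z : ℂ => globalFlow (hK u 0) (hB u 0) (-2 + (z.im : ℂ) * I) (z.re + 2)) = id := by
    intro u
    funext z
    have h1 : ∀ w : ℂ, exp (((Real.smoothTransition 0 : ℝ) : ℂ) * Θ u w) = 1 := fun w => by
      rw [Real.smoothTransition.zero, ofReal_zero, zero_mul, exp_zero]
    rw [globalFlow_eq_add_of_forall_eq_one (hK u 0) (hB u 0) h1]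
    apply Complex.ext <;> simp
  -- the family of ambient isotopies
  set A : P → AmbientIsotopy 𝓘(ℝ, ℂ) ℂ := fun u =>
    { toFun := fun τ z => globalFlow (hK u τ) (hB u τ) (-2 + (z.im : ℂ) * I) (z.re + 2)
      contMDiff := contMDiff_prod_self_of_contDiff (hjoint_u u)
      bijective := fun τ => ⟨injective_flowStraighten (hK u τ) (hB u τ) (hout u τ),
        surjective_flowStraighten (hK u τ) (hB u τ) (hout u τ) (hesc u τ)⟩
      isLocalDiffeomorph := fun τ z => by
        obtain ⟨M, hM⟩ := exists_clEquiv_fderiv_globalFlow (hC1 u τ) (hK u τ) (hB u τ) (z.re + 2) (-2 + z.im * I)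
        refine isLocalDiffeomorphAt_of_hasFDerivAt_writtenInExtChartAt (U := univ) isOpen_univ
          (mem_univ z) (hstage u τ).contMDiff.contMDiffOn (by simp) M ?_
        rw [hM]
        exact hasFDerivAt_flowStraighten (hC1 u τ) (hK u τ) (hB u τ) (hout u τ) z
      map_zero := h0 u } with hA
  refine ⟨A, hjoint, fun u hu τ z => ?_, fun u => ⟨fun τ z hz => ?_, fun τ z hz => ?_, fun τ z d hd hz => ?_,
    fun τ z => ?_, fun τ z hz => ?_, fun F hF hFX hFout z => ?_⟩⟩
  · -- naturality at a trivial parameter: the field is `1`, the flow is translation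
    show globalFlow (hK u τ) (hB u τ) (-2 + (z.im : ℂ) * I) (z.re + 2) = z
    have h1 : ∀ w : ℂ, exp (((Real.smoothTransition τ : ℝ) : ℂ) * Θ u w) = 1 := fun w => by
      rw [hu w, mul_zero, exp_zero]
    rw [globalFlow_eq_add_of_forall_eq_one (hK u τ) (hB u τ) h1]
    apply Complex.ext <;> simp
  · exact flowStraighten_eq_self_of_one_le_abs_im (hK u τ) (hB u τ) (hout u τ) hz
  · exact flowStraighten_eq_self_of_re_le (hK u τ) (hB u τ) (hout u τ) hz
  · exact flowStraighten_add_of_one_le_re (hK u τ) (hB u τ) (hout u τ) hz hd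
  · exact re_flowStraighten_le (hK u τ) (hB u τ) (hout u τ) z
  · show fderiv ℝ (fun z : ℂ => globalFlow (hK u τ) (hB u τ) (-2 + (z.im : ℂ) * I) (z.re + 2)) z 1 = 1
    rw [(hasFDerivAt_flowStraighten (hC1 u τ) (hK u τ) (hB u τ) (hout u τ) z).fderiv]
    have hXp : exp (((Real.smoothTransition τ : ℝ) : ℂ) * Θ u (-2 + z.im * I)) = 1 :=
      hout u τ _ (one_le_norm_of_re_im (Or.inl (by simp)))
    have := fderiv_globalFlow_apply_self (hC1 u τ) (hK u τ) (hB u τ) (z.re + 2) (-2 + z.im * I)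
    rw [hXp] at this
    rw [this]
    exact hout u τ _ hz
  · show F (globalFlow (hK u 1) (hB u 1) (-2 + (z.im : ℂ) * I) (z.re + 2)) = z.im
    have h1 : ∀ w : ℂ, exp (((Real.smoothTransition 1 : ℝ) : ℂ) * Θ u w) = exp (Θ u w) := fun w => by
      rw [Real.smoothTransition.one, ofReal_one, one_mul]
    have hconst : ∀ s : ℝ, F (globalFlow (hK u 1) (hB u 1) (-2 + (z.im : ℂ) * I) s) =
        F (globalFlow (hK u 1) (hB u 1) (-2 + (z.im : ℂ) * I) 0) := by
      intro s
      have hd : ∀ s : ℝ, HasDerivAt (fun s : ℝ => F (globalFlow (hK u 1) (hB u 1) (-2 + (z.im : ℂ) * I) s))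
          (fderiv ℝ F (globalFlow (hK u 1) (hB u 1) (-2 + (z.im : ℂ) * I) s)
            (exp (((Real.smoothTransition 1 : ℝ) : ℂ) * Θ u (globalFlow (hK u 1) (hB u 1) (-2 + (z.im : ℂ) * I) s)))) s :=
        fun s => (hF _).hasFDerivAt.comp_hasDerivAt s (hasDerivAt_globalFlow (hK u 1) (hB u 1) _ s)
      refine is_const_of_deriv_eq_zero (f := fun s : ℝ => F (globalFlow (hK u 1) (hB u 1) (-2 + (z.im : ℂ) * I) s))
        (fun s => (hd s).differentiableAt) (fun s => ?_) s 0
      rw [(hd s).deriv, h1]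
      exact hFX _
    rw [hconst, globalFlow_zero, hFout _ (one_le_norm_of_re_im (Or.inl (by simp)))]
    simp

end Family

/-! ### The angle functions of a smooth family of diffeomorphisms -/

section AngleFamily

/-- `P × ℂ` is simply connected (a real normed space is contractible). [folklore] -/
theorem isSimplyConnected_univ_prod_complex {P : Type*} [NormedAddCommGroup P] [NormedSpace ℝ P] :
    IsSimplyConnected (univ : Set (P × ℂ)) := by
  have : ContractibleSpace (univ : Set (P × ℂ)) := (convex_univ).contractibleSpace ⟨0, trivial⟩
  change SimplyConnectedSpace (univ : Set (P × ℂ))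
  infer_instance

variable {P : Type*} [NormedAddCommGroup P] [NormedSpace ℝ P]

/-- **The angle functions of a smooth family** (families form of `exists_angle_of_diffeomorph`;
Smale 1959, proof of Thm. B, first step; Cerf 1968, Appendice §5, Théorème 4). Let `g : P → ℂ → ℂ`
be jointly smooth, each `g_u` the identity off the closed unit disc with invertible derivative
everywhere (`g_u` is the inverse of the diffeomorphism `s_u` to be deformed), `F_u = Im ∘ g_u`.
Then there is `Θ : P → ℂ → ℂ`, **jointly smooth**, each `Θ_u` purely imaginary and zero off the
disc, with `exp (Θ_u)` annihilated by `dF_u` (the unit tangent field of the level curves of `F_u`),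
and **`Θ_u = 0` at every parameter where `g_u = id`**. The logarithm is taken on the simply
connected space `P × ℂ` and normalised on the connected set `P × {‖z‖ ≥ 1}`; at a trivial
parameter the field is `1` and its normalised logarithm vanishes by connectedness of `ℂ`.
[cite: CerfDiffeoSphere1968, Appendice §5, Théorème 4] -/
theorem exists_angle_family {g : P → ℂ → ℂ} (hgc : ContDiff ℝ ∞ fun q : P × ℂ => g q.1 q.2)
    (hgout : ∀ (u : P) (z : ℂ), 1 ≤ ‖z‖ → g u z = z) (hDg : ∀ (u : P) (z : ℂ), IsUnit (fderiv ℝ (g u) z)) :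
    ∃ Θ : P → ℂ → ℂ, (ContDiff ℝ ∞ fun q : P × ℂ => Θ q.1 q.2) ∧ (∀ u z, 1 ≤ ‖z‖ → Θ u z = 0) ∧
      (∀ u z, (Θ u z).re = 0) ∧ (∀ u z, fderiv ℝ (fun w : ℂ => (g u w).im) z (exp (Θ u z)) = 0) ∧
      (∀ u, (∀ z, g u z = z) → ∀ z, Θ u z = 0) := by
  have hgu : ∀ u, ContDiff ℝ ∞ (g u) := fun u => hgc.comp (contDiff_const.prodMk contDiff_id)
  have hgd : ∀ u, Differentiable ℝ (g u) := fun u => (hgu u).differentiable (by simp)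
  -- the functions `F_u = Im ∘ g_u`, jointly, and their partial derivatives in `z`
  set Fj : P × ℂ → ℝ := fun q => (g q.1 q.2).im with hFj_def
  have hFjc : ContDiff ℝ ∞ Fj := Complex.imCLM.contDiff.comp hgc
  have hFu : ∀ u, ContDiff ℝ ∞ fun w : ℂ => (g u w).im := fun u => Complex.imCLM.contDiff.comp (hgu u)
  have hFd : ∀ (u : P) (z : ℂ), HasFDerivAt (fun w : ℂ => (g u w).im) (Complex.imCLM.comp (fderiv ℝ (g u) z)) z :=
    fun u z => Complex.imCLM.hasFDerivAt.comp z ((hgd u) z).hasFDerivAt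
  have hpart : ∀ (q : P × ℂ) (v : ℂ), fderiv ℝ (fun w : ℂ => (g q.1 w).im) q.2 v = fderiv ℝ Fj q (0, v) := by
    intro q v
    have h1 : HasFDerivAt Fj (fderiv ℝ Fj q) (q.1, q.2) := (hFjc.differentiable (by simp) q).hasFDerivAt
    have h2 : HasFDerivAt (fun w : ℂ => ((q.1, w) : P × ℂ)) (ContinuousLinearMap.inr ℝ P ℂ) q.2 :=
      hasFDerivAt_prodMk_right q.1 q.2
    have h3 := h1.comp q.2 h2
    have h4 : (Fj ∘ fun w : ℂ => ((q.1, w) : P × ℂ)) = fun w : ℂ => (g q.1 w).im := rfl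
    rw [h4] at h3
    rw [h3.fderiv]
    rfl
  -- the complex gradient `W = ∂ₓF + i ∂_yF`, jointly smooth
  set W : P × ℂ → ℂ := fun q => ((fderiv ℝ (fun w : ℂ => (g q.1 w).im) q.2 1 : ℝ) : ℂ) +
    ((fderiv ℝ (fun w : ℂ => (g q.1 w).im) q.2 I : ℝ) : ℂ) * I with hW_def
  have hWc : ContDiff ℝ ∞ W := by
    have h1 : ContDiff ℝ ∞ (fderiv ℝ Fj) := hFjc.fderiv_right (by simp)
    have h2 : ∀ v : ℂ, ContDiff ℝ ∞ fun q : P × ℂ => fderiv ℝ (fun w : ℂ => (g q.1 w).im) q.2 v := by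
      intro v
      have : (fun q : P × ℂ => fderiv ℝ (fun w : ℂ => (g q.1 w).im) q.2 v) = fun q => fderiv ℝ Fj q (0, v) :=
        funext fun q => hpart q v
      rw [this]
      exact h1.clm_apply contDiff_const
    exact (ofRealCLM.contDiff.comp (h2 1)).add ((ofRealCLM.contDiff.comp (h2 I)).mul contDiff_const)
  have hWu : ∀ u, ContDiff ℝ ∞ fun z : ℂ => W (u, z) := fun u => hWc.comp (contDiff_const.prodMk contDiff_id)
  -- `dF(v) = Re v ∂ₓF + Im v ∂_yF`
  have hDF : ∀ (u : P) (z v : ℂ), fderiv ℝ (fun w : ℂ => (g u w).im) z v =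
      v.re * fderiv ℝ (fun w : ℂ => (g u w).im) z 1 + v.im * fderiv ℝ (fun w : ℂ => (g u w).im) z I := by
    intro u z v
    have e : v = v.re • (1 : ℂ) + v.im • I := by
      apply Complex.ext <;> simp
    conv_lhs => rw [e]
    rw [map_add, map_smul, map_smul, smul_eq_mul, smul_eq_mul]
  -- `W ≠ 0` (the derivative of `g_u` is onto)
  have hW0 : ∀ q, W q ≠ 0 := by
    intro q hq
    have h1 : fderiv ℝ (fun w : ℂ => (g q.1 w).im) q.2 1 = 0 ∧ fderiv ℝ (fun w : ℂ => (g q.1 w).im) q.2 I = 0 := by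
      have hre := congrArg re hq
      have him := congrArg im hq
      simp only [hW_def, add_re, ofReal_re, mul_re, I_re, mul_zero, ofReal_im, I_im, mul_one, sub_self,
        add_zero, zero_re, add_im, mul_im, zero_add, zero_im] at hre him
      exact ⟨hre, him⟩
    have h2 : ∀ v, fderiv ℝ (fun w : ℂ => (g q.1 w).im) q.2 v = 0 := fun v => by
      rw [hDF, h1.1, h1.2, mul_zero, mul_zero, add_zero]
    obtain ⟨w, hw⟩ := hDg q.1 q.2
    have h3 := h2 ((↑w⁻¹ : ℂ →L[ℝ] ℂ) I)
    rw [(hFd q.1 q.2).fderiv, ContinuousLinearMap.comp_apply, ← hw] at h3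
    have h4 : ((↑w : ℂ →L[ℝ] ℂ)) ((↑w⁻¹ : ℂ →L[ℝ] ℂ) I) = I := by
      rw [← ContinuousLinearMap.comp_apply, ← ContinuousLinearMap.mul_def, ← Units.val_mul,
        mul_inv_cancel, Units.val_one]
      rfl
    rw [h4] at h3
    simp at h3
  -- `W = i` off the disc, and everywhere at a trivial parameter
  have hfd_id : ∀ (u : P) (z : ℂ), (fun w : ℂ => (g u w).im) =ᶠ[𝓝 z] (fun w : ℂ => w.im) →
      W (u, z) = I := by
    intro u z hev
    have hfd : fderiv ℝ (fun w : ℂ => (g u w).im) z = Complex.imCLM := by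
      rw [hev.fderiv_eq]; exact Complex.imCLM.fderiv
    simp only [hW_def, hfd]
    simp
  have hWout : ∀ (u : P) (z : ℂ), 1 ≤ ‖z‖ → W (u, z) = I := by
    intro u
    refine eqOn_of_eqOn_setOf_one_lt_norm (hWu u).continuous fun z hz => hfd_id u z ?_
    have hopen : IsOpen {w : ℂ | 1 < ‖w‖} := isOpen_lt continuous_const continuous_norm
    filter_upwards [hopen.mem_nhds hz] with w hw
    rw [hgout u w hw.le]
  have hWtriv : ∀ u, (∀ z, g u z = z) → ∀ z, W (u, z) = I := fun u hu z =>
    hfd_id u z (Eventually.of_forall fun w => by simp only [hu w])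
  -- the unit field `X₁ = -i W/‖W‖`
  set X₁ : P × ℂ → ℂ := fun q => -I * W q * (((‖W q‖)⁻¹ : ℝ) : ℂ) with hX₁_def
  have hX₁c : ContDiff ℝ ∞ X₁ := by
    refine contDiff_iff_contDiffAt.2 fun q => ?_
    have h1 : ContDiffAt ℝ ∞ (fun q => ‖W q‖) q := (hWc.contDiffAt).norm ℝ (hW0 q)
    exact ((contDiffAt_const.mul hWc.contDiffAt).mul (ofRealCLM.contDiff.contDiffAt.comp q (h1.inv (norm_ne_zero_iff.2 (hW0 q)))))
  have hX₁norm : ∀ q, ‖X₁ q‖ = 1 := by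
    intro q
    have h := norm_ne_zero_iff.2 (hW0 q)
    simp only [hX₁_def, norm_mul, norm_neg, norm_I, one_mul, norm_real, Real.norm_eq_abs, abs_inv, abs_norm]
    exact mul_inv_cancel₀ h
  have hX₁0 : ∀ q, X₁ q ≠ 0 := fun q => norm_ne_zero_iff.1 (by rw [hX₁norm]; exact one_ne_zero)
  have hX₁_of_W : ∀ q, W q = I → X₁ q = 1 := by
    intro q hq
    show -I * W q * (((‖W q‖)⁻¹ : ℝ) : ℂ) = 1
    rw [hq, norm_I, inv_one, ofReal_one, mul_one, neg_mul, I_mul_I, neg_neg]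
  have hX₁out : ∀ (u : P) (z : ℂ), 1 ≤ ‖z‖ → X₁ (u, z) = 1 := fun u z hz => hX₁_of_W _ (hWout u z hz)
  -- `X₁` is annihilated by `dF`
  have hX₁F : ∀ q : P × ℂ, fderiv ℝ (fun w : ℂ => (g q.1 w).im) q.2 (X₁ q) = 0 := by
    intro q
    rw [hDF]
    have hre : (X₁ q).re = fderiv ℝ (fun w : ℂ => (g q.1 w).im) q.2 I * (‖W q‖)⁻¹ := by
      simp [hX₁_def, hW_def]
    have him : (X₁ q).im = -(fderiv ℝ (fun w : ℂ => (g q.1 w).im) q.2 1) * (‖W q‖)⁻¹ := by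
      simp [hX₁_def, hW_def]
    rw [hre, him]
    ring
  -- a continuous logarithm on the simply connected `P × ℂ`, normalised off the disc
  obtain ⟨Θ₀, hΘ₀c, hΘ₀e⟩ := hasLogOn_univ isSimplyConnected_univ_prod_complex hX₁c.continuous hX₁0
  have hΘ₀c' : Continuous Θ₀ := continuousOn_univ.1 hΘ₀c
  have hΘ₀e' : ∀ q, exp (Θ₀ q) = X₁ q := fun q => hΘ₀e q (mem_univ q)
  have hΘ₀re : ∀ q, (Θ₀ q).re = 0 := by
    intro q
    have h := congrArg norm (hΘ₀e' q)
    rw [Complex.norm_exp, hX₁norm] at h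
    exact (Real.exp_eq_one_iff _).1 h
  have hSconn : IsPreconnected ((univ : Set P) ×ˢ {z : ℂ | 1 ≤ ‖z‖}) :=
    isPreconnected_univ.prod isPreconnected_setOf_one_le_norm
  obtain ⟨n, hn⟩ := exists_int_eq_add_of_exp_eq hSconn (l := Θ₀) (m := fun _ => (0 : ℂ)) hΘ₀c'.continuousOn
    continuousOn_const (fun q hq => by
      rw [hΘ₀e' q, exp_zero]
      exact hX₁out q.1 q.2 hq.2)
  set Θ : P × ℂ → ℂ := fun q => Θ₀ q - n * (2 * π * I) with hΘ_def
  have hΘe : ∀ q, exp (Θ q) = X₁ q := by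
    intro q
    simp only [hΘ_def]
    rw [exp_sub, hΘ₀e' q, exp_int_mul_two_pi_mul_I, div_one]
  have hΘout : ∀ (u : P) (z : ℂ), 1 ≤ ‖z‖ → Θ (u, z) = 0 := by
    intro u z hz
    simp only [hΘ_def]
    rw [hn (u, z) ⟨mem_univ _, hz⟩, zero_add, sub_self]
  have hΘre : ∀ q, (Θ q).re = 0 := by
    intro q
    simp only [hΘ_def, sub_re, hΘ₀re q]
    simp
  have hΘc : Continuous Θ := hΘ₀c'.sub continuous_const
  -- smoothness: locally `Θ` is a principal logarithm up to a constant
  have hΘsmooth : ContDiff ℝ ∞ Θ := by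
    refine contDiff_iff_contDiffAt.2 fun q₀ => ?_
    have hc0 : X₁ q₀ ≠ 0 := hX₁0 q₀
    have hRc : ContDiff ℝ ∞ fun q => X₁ q / X₁ q₀ := hX₁c.div_const _
    have hR1 : X₁ q₀ / X₁ q₀ = 1 := div_self hc0
    have hopen : IsOpen {q : P × ℂ | ‖X₁ q / X₁ q₀ - 1‖ < 1} :=
      isOpen_lt ((hRc.continuous.sub continuous_const).norm) continuous_const
    have hmem : q₀ ∈ {q : P × ℂ | ‖X₁ q / X₁ q₀ - 1‖ < 1} := by
      show ‖X₁ q₀ / X₁ q₀ - 1‖ < 1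
      rw [hR1, sub_self, norm_zero]; exact one_pos
    obtain ⟨r, hr0, hr⟩ := Metric.isOpen_iff.1 hopen q₀ hmem
    have hslit : ∀ q ∈ ball q₀ r, X₁ q / X₁ q₀ ∈ slitPlane := fun q hq => by
      have := mem_slitPlane_of_norm_lt_one (hr hq)
      simpa using this
    obtain ⟨m, hm⟩ := exists_int_eq_add_of_exp_eq (convex_ball q₀ r).isPreconnected
      (l := fun q => Θ q - Θ q₀) (m := fun q => log (X₁ q / X₁ q₀))
      ((hΘc.sub continuous_const).continuousOn)
      ((hRc.continuous.continuousOn).clog hslit) (fun q hq => by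
        rw [exp_sub, hΘe, hΘe, exp_log (slitPlane_ne_zero (hslit q hq))])
    have hev : Θ =ᶠ[𝓝 q₀] fun q => log (X₁ q / X₁ q₀) + (Θ q₀ + m * (2 * π * I)) := by
      filter_upwards [ball_mem_nhds q₀ hr0] with q hq
      have := hm q hq
      linear_combination this
    refine ContDiffAt.congr_of_eventuallyEq ?_ hev
    refine ContDiffAt.add ?_ contDiffAt_const
    have hlog : ContDiffAt ℝ ∞ log (X₁ q₀ / X₁ q₀) := by
      have := Complex.contDiffAt_log (x := X₁ q₀ / X₁ q₀) (n := ∞) (by rw [hR1]; exact one_mem_slitPlane)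
      exact this.restrict_scalars ℝ
    exact hlog.comp q₀ hRc.contDiffAt
  refine ⟨fun u z => Θ (u, z), hΘsmooth, hΘout, fun u z => hΘre (u, z), fun u z => ?_, fun u hu z => ?_⟩
  · show fderiv ℝ (fun w : ℂ => (g u w).im) z (exp (Θ (u, z))) = 0
    rw [hΘe]
    exact hX₁F (u, z)
  · -- naturality: `X₁ (u, ·) = 1`, so `Θ (u, ·) ∈ 2πiℤ` is constant, and it vanishes off the disc
    have h1 : ∀ w : ℂ, exp (Θ (u, w)) = exp 0 := fun w => by
      rw [hΘe, exp_zero]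
      exact hX₁_of_W _ (hWtriv u hu w)
    obtain ⟨k, hk⟩ := exists_int_eq_add_of_exp_eq isPreconnected_univ (l := fun w : ℂ => Θ (u, w))
      (m := fun _ => (0 : ℂ)) ((hΘc.comp (Continuous.prodMk_right u)).continuousOn) continuousOn_const
      (fun w _ => h1 w)
    have h2 := hk 2 (mem_univ _)
    rw [hΘout u 2 (by simp), zero_add] at h2
    have hk0 : (k : ℂ) * (2 * π * I) = 0 := h2.symm
    show Θ (u, z) = 0
    rw [hk z (mem_univ z), zero_add, hk0]

end AngleFamily

/-! ### Fibrewise convexity in smooth families -/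

section StraightLineFamily

variable {P : Type*} [NormedAddCommGroup P] [NormedSpace ℝ P] [CompleteSpace P]
  {E : Type*} [NormedAddCommGroup E] [NormedSpace ℝ E] [CompleteSpace E]

/-- **Fibrewise convexity in smooth families** (families form of
`exists_compactDiffeotopy_of_forall_sub_mem_span`; Cerf 1968, Appendice §5, p. 131, "le groupe des
difféomorphismes de `R` conservant l'orientation est convexe"). Let `c : P → E → ℝ` be jointly
smooth, `c_u = 0` off the ball `B̄(0, R)`, and suppose each `w_u : p ↦ p + c_u(p) e₁` (`e₁ ≠ 0`) is
injective with invertible derivative everywhere. Then the straight-line family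
`L^u_t : p ↦ p + χ(t) c_u(p) e₁` (`χ` the smooth transition) consists of bijections, and its
**inverses `(u, t, y) ↦ (L^u_t)⁻¹ y` are jointly smooth**; they are the identity off `B̄(0, R)`.
[cite: CerfDiffeoSphere1968, Appendice §5, p. 131] -/
theorem exists_straightLine_inverse_family {e₁ : E} (he₁ : e₁ ≠ 0) {c : P → E → ℝ}
    (hc : ContDiff ℝ ∞ fun q : P × E => c q.1 q.2) {R : ℝ} (hcR : ∀ (u : P) (p : E), R ≤ ‖p‖ → c u p = 0)
    (hinj : ∀ u : P, Injective fun p : E => p + c u p • e₁)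
    (hunit : ∀ (u : P) (p : E), IsUnit (fderiv ℝ (fun p : E => p + c u p • e₁) p)) :
    ∃ Linv : P → ℝ → E → E,
      (ContDiff ℝ ∞ fun q : P × ℝ × E => Linv q.1 q.2.1 q.2.2) ∧
      (∀ (u : P) (t : ℝ) (p : E), Linv u t (p + (Real.smoothTransition t * c u p) • e₁) = p) ∧
      (∀ (u : P) (t : ℝ) (y : E), Linv u t y + (Real.smoothTransition t * c u (Linv u t y)) • e₁ = y) ∧
      (∀ (u : P) (t : ℝ) (y : E), R ≤ ‖y‖ → Linv u t y = y) := by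
  have hcu : ∀ u, ContDiff ℝ ∞ (c u) := fun u => hc.comp (contDiff_const.prodMk contDiff_id)
  have hcd : ∀ u, Differentiable ℝ (c u) := fun u => (hcu u).differentiable (by simp)
  -- the pivot `a u p = 1 + Dc_u(p) e₁` is positive
  set a : P → E → ℝ := fun u p => 1 + fderiv ℝ (c u) p e₁ with ha
  have hDw : ∀ u p, HasFDerivAt (fun p : E => p + c u p • e₁)
      (ContinuousLinearMap.id ℝ E + (fderiv ℝ (c u) p).smulRight e₁) p := fun u p =>
    (hasFDerivAt_id p).add (((hcd u) p).hasFDerivAt.smul_const e₁)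
  have hDwe : ∀ u p, fderiv ℝ (fun p : E => p + c u p • e₁) p e₁ = a u p • e₁ := by
    intro u p
    rw [(hDw u p).fderiv]
    simp [ha, add_smul]
  have ha_ne : ∀ u p, a u p ≠ 0 := by
    intro u p h0
    have h1 : fderiv ℝ (fun p : E => p + c u p • e₁) p e₁ = 0 := by rw [hDwe, h0, zero_smul]
    obtain ⟨w, hw⟩ := hunit u p
    apply he₁
    calc e₁ = ((↑(w⁻¹ * w) : E →L[ℝ] E)) e₁ := by
          rw [inv_mul_cancel, Units.val_one]; rfl
      _ = ((↑w⁻¹ : (E →L[ℝ] E)ˣ) : E →L[ℝ] E) ((↑w : E →L[ℝ] E) e₁) := rfl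
      _ = 0 := by rw [hw, h1, map_zero]
  have hm_deriv : ∀ u p x, HasDerivAt (fun x : ℝ => x + c u (p + x • e₁)) (a u (p + x • e₁)) x := by
    intro u p x
    have h1 : HasDerivAt (fun x : ℝ => p + x • e₁) e₁ x := by
      simpa using ((hasDerivAt_id x).smul_const e₁).const_add p
    have h2 : HasDerivAt (fun x : ℝ => c u (p + x • e₁)) (fderiv ℝ (c u) (p + x • e₁) e₁) x :=
      ((hcd u) _).hasFDerivAt.comp_hasDerivAt x h1
    exact (hasDerivAt_id x).add h2
  have ha_pos : ∀ u p, 0 < a u p := by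
    intro u p
    set m : ℝ → ℝ := fun x => x + c u (p + x • e₁) with hm
    have hmc : Continuous m := continuous_id.add ((hcu u).continuous.comp (by fun_prop))
    have hmi : Injective m := by
      intro x x' h
      have h1 : (fun p : E => p + c u p • e₁) (p + x • e₁) = (fun p : E => p + c u p • e₁) (p + x' • e₁) := by
        show p + x • e₁ + c u (p + x • e₁) • e₁ = p + x' • e₁ + c u (p + x' • e₁) • e₁
        rw [add_assoc, add_assoc, ← add_smul, ← add_smul]
        exact congrArg (fun c : ℝ => p + c • e₁) h
      have h2 := hinj u h1
      rw [add_right_inj] at h2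
      exact smul_left_injective ℝ he₁ h2
    have hmA : ∀ x, (|R| + ‖p‖) / ‖e₁‖ ≤ |x| → m x = x := by
      intro x hx
      have hn : 0 < ‖e₁‖ := norm_pos_iff.mpr he₁
      have h1 : R ≤ ‖p + x • e₁‖ := by
        have h2 : |x| * ‖e₁‖ - ‖p‖ ≤ ‖p + x • e₁‖ := by
          have := norm_sub_norm_le (x • e₁) (-p)
          rw [norm_smul, Real.norm_eq_abs, norm_neg, sub_neg_eq_add, add_comm] at this
          linarith
        rw [div_le_iff₀ hn] at hx
        linarith [le_abs_self R]
      simp only [hm, hcR u _ h1, add_zero]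
    have hmono := strictMono_of_injective_of_eq_self hmc hmi hmA
    have h0 : 0 ≤ a u (p + (0 : ℝ) • e₁) := by
      rw [← (hm_deriv u p 0).deriv]
      exact hmono.monotone.deriv_nonneg
    rw [zero_smul, add_zero] at h0
    exact lt_of_le_of_ne h0 (Ne.symm (ha_ne u p))
  -- the straight-line family and its rows
  set χ := Real.smoothTransition with hχ
  have hχ0 : ∀ t, 0 ≤ χ t := Real.smoothTransition.nonneg
  have hχ1 : ∀ t, χ t ≤ 1 := Real.smoothTransition.le_one
  set L : P → ℝ → E → E := fun u t p => p + (χ t * c u p) • e₁ with hL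
  have hpivot : ∀ u t p, 0 < 1 + χ t * fderiv ℝ (c u) p e₁ := by
    intro u t p
    have h1 : 1 + χ t * fderiv ℝ (c u) p e₁ = (1 - χ t) + χ t * a u p := by simp only [ha]; ring
    rw [h1]
    rcases (hχ0 t).eq_or_lt with h0 | h0
    · rw [← h0]; norm_num
    · nlinarith [hχ1 t, ha_pos u p]
  have hLderiv : ∀ u t p, HasFDerivAt (L u t)
      (ContinuousLinearMap.id ℝ E + (χ t • fderiv ℝ (c u) p).smulRight e₁) p := fun u t p =>
    (hasFDerivAt_id p).add ((((hcd u) p).hasFDerivAt.const_mul (χ t)).smul_const e₁)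
  have hrow : ∀ u t p x, L u t (p + x • e₁) = p + (x + χ t * c u (p + x • e₁)) • e₁ := by
    intro u t p x; simp only [hL, add_smul, add_assoc]
  have hrow_deriv : ∀ u t p x, HasDerivAt (fun x : ℝ => x + χ t * c u (p + x • e₁))
      (1 + χ t * fderiv ℝ (c u) (p + x • e₁) e₁) x := by
    intro u t p x
    have h1 : HasDerivAt (fun x : ℝ => p + x • e₁) e₁ x := by
      simpa using ((hasDerivAt_id x).smul_const e₁).const_add p
    have h2 : HasDerivAt (fun x : ℝ => c u (p + x • e₁)) (fderiv ℝ (c u) (p + x • e₁) e₁) x :=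
      ((hcd u) _).hasFDerivAt.comp_hasDerivAt x h1
    exact (hasDerivAt_id x).add (h2.const_mul _)
  have hrow_mono : ∀ u t p, StrictMono fun x : ℝ => x + χ t * c u (p + x • e₁) := fun u t p =>
    strictMono_of_deriv_pos fun x => by rw [(hrow_deriv u t p x).deriv]; exact hpivot u t _
  have hrow_cont : ∀ u t p, Continuous fun x : ℝ => x + χ t * c u (p + x • e₁) := fun u t p =>
    continuous_id.add (continuous_const.mul ((hcu u).continuous.comp (by fun_prop)))
  have hLfix : ∀ u t p, R ≤ ‖p‖ → L u t p = p := fun u t p hp => by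
    simp only [hL, hcR u p hp, mul_zero, zero_smul, add_zero]
  have hLinj : ∀ u t, Injective (L u t) := by
    intro u t q q' h
    set y : ℝ := χ t * c u q - χ t * c u q' with hy
    have hq' : q' = q + y • e₁ := by
      have h1 : q + (χ t * c u q) • e₁ = q' + (χ t * c u q') • e₁ := h
      have h2 : q' = q + (χ t * c u q) • e₁ - (χ t * c u q') • e₁ := eq_sub_of_add_eq h1.symm
      rw [h2, hy, sub_smul]
      abel
    have h2 : (fun x : ℝ => x + χ t * c u (q + x • e₁)) 0 = (fun x : ℝ => x + χ t * c u (q + x • e₁)) y := by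
      have h3 : L u t (q + (0 : ℝ) • e₁) = L u t (q + y • e₁) := by rw [zero_smul, add_zero, ← hq', h]
      rw [hrow, hrow] at h3
      have h4 := add_left_cancel h3
      exact smul_left_injective ℝ he₁ h4
    have h5 : (0 : ℝ) = y := (hrow_mono u t q).injective h2
    rw [hq', ← h5, zero_smul, add_zero]
  have hLsurj : ∀ u t, Surjective (L u t) := by
    intro u t w
    set n : ℝ → ℝ := fun x => x + χ t * c u (w + x • e₁) with hn
    have hn_far : ∀ x, (|R| + ‖w‖) / ‖e₁‖ ≤ |x| → n x = x := by
      intro x hx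
      have hne' : 0 < ‖e₁‖ := norm_pos_iff.mpr he₁
      have h1 : R ≤ ‖w + x • e₁‖ := by
        have h2 : |x| * ‖e₁‖ - ‖w‖ ≤ ‖w + x • e₁‖ := by
          have := norm_sub_norm_le (x • e₁) (-w)
          rw [norm_smul, Real.norm_eq_abs, norm_neg, sub_neg_eq_add, add_comm] at this
          linarith
        rw [div_le_iff₀ hne'] at hx
        linarith [le_abs_self R]
      simp only [hn, hcR u _ h1, mul_zero, add_zero]
    set B : ℝ := (|R| + ‖w‖) / ‖e₁‖ + 1 with hB
    have hB0 : 0 ≤ (|R| + ‖w‖) / ‖e₁‖ := by positivity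
    have hB1 : 0 < B := by rw [hB]; positivity
    have hBabs : |B| = B := abs_of_pos hB1
    have hnB : n B = B := hn_far B (by rw [hBabs, hB]; linarith)
    have hnB' : n (-B) = -B := hn_far (-B) (by rw [abs_neg, hBabs, hB]; linarith)
    have h0 : (0 : ℝ) ∈ Icc (n (-B)) (n B) := by rw [hnB, hnB']; constructor <;> linarith
    obtain ⟨x, -, hx⟩ := intermediate_value_Icc (by linarith) (hrow_cont u t w).continuousOn h0
    refine ⟨w + x • e₁, ?_⟩
    rw [hrow]
    have hx' : x + χ t * c u (w + x • e₁) = 0 := hx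
    rw [hx', zero_smul, add_zero]
  -- the inverse family and its smoothness
  obtain ⟨Linv, hLLinv, hLinvL⟩ : ∃ Linv : P → ℝ → E → E,
      (∀ u t y, L u t (Linv u t y) = y) ∧ (∀ u t p, Linv u t (L u t p) = p) :=
    ⟨fun u t => Function.surjInv (hLsurj u t), fun u t y => Function.surjInv_eq (hLsurj u t) y,
      fun u t p => Function.leftInverse_surjInv ⟨hLinj u t, hLsurj u t⟩ p⟩
  have hsmooth : ContDiff ℝ ∞ fun q : (P × ℝ) × E => L q.1.1 q.1.2 q.2 := by
    show ContDiff ℝ ∞ fun q : (P × ℝ) × E => q.2 + (χ q.1.2 * c q.1.1 q.2) • e₁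
    exact contDiff_snd.add (((Real.smoothTransition.contDiff.comp (contDiff_snd.comp contDiff_fst)).mul
      (hc.comp ((contDiff_fst.comp contDiff_fst).prodMk contDiff_snd))).smul contDiff_const)
  have hinv_smooth : ContDiff ℝ ∞ fun q : (P × ℝ) × E => Linv q.1.1 q.1.2 q.2 := by
    refine contDiff_inverse_family (F := fun (w : P × ℝ) (p : E) => L w.1 w.2 p)
      (G := fun (w : P × ℝ) (y : E) => Linv w.1 w.2 y) hsmooth
      (fun w p => hLinvL w.1 w.2 p) (fun w y => hLLinv w.1 w.2 y) fun w p => ?_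
    obtain ⟨M, hM⟩ := exists_continuousLinearEquiv_rankOne (fderiv ℝ (c w.1) p) e₁ (χ w.2) (hpivot w.1 w.2 p).ne'
    exact ⟨M, by rw [hM]; exact hLderiv w.1 w.2 p⟩
  refine ⟨Linv, hinv_smooth.comp ((contDiff_fst.prodMk (contDiff_fst.comp contDiff_snd)).prodMk
    (contDiff_snd.comp contDiff_snd)), fun u t p => hLinvL u t p, fun u t y => hLLinv u t y, fun u t y hy => ?_⟩
  have h1 : L u t y = y := hLfix u t y hy
  conv_lhs => rw [← h1]
  exact hLinvL u t y

end StraightLineFamily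

end Literature.Topology.FourManifolds
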